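import Mathlib
import HarnessLib
import Literature.AlgebraicGeometry.Resolution.PrimeDivisorIdeals
import Summits.ResolutionOfSingularities.ResolutionOfSingularities.Theorems.WildQuotientsWildQuotientResolutionKSBlowupFixedPointCentre

/-!
# Kollár–Szabó going down, (K2-centres), local structure: the local ring of a blow-up at the image of the closed
# point of a LOCALISED CHART `R ⊇ 𝒪_{X,x}[I_x/a₀]` is `R` (crux `WildQuotients.WildQuotientResolution`, stub `stub_phaseZeroHighDim`)

Crux stmt-ResolutionOfSingularities-15640 (`WildQuotientResolution`), registered stub `stub_phaseZeroHighDim`;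
programme PHASE0-KS-EIGENLINE, item (K2-centres-stalk) of hand 8-g3's remaining list. Hand 8-g2's
✓`KSGoingDown.stalkClosedPointTo_surjective_of_isQuadraticTransform_of_stalkIdeal` identifies `𝒪_{X',x'}` with the
quadratic transform `S[𝔪/x₀]_𝔫` for centres with `I_x = 𝔪_x`. This file proves the same for an ARBITRARY centre `I`
and an ARBITRARY "localised chart": a local subring `R ⊆ Frac 𝒪_{X,x}` with local structure map `ι`, an element
`a₀ ∈ I_x` with `I_x R = (ι a₀)`, a subring `B ⊆ S[I_x/a₀]` (`S` the image of `𝒪_{X,x}`) of which `R` is a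
localisation (`r = a/b`, `a, b ∈ B`, `b⁻¹ ∈ R`) — e.g. the MONOIDAL TRANSFORM `S[J/t]_𝔫` of
✓`CentreChart.exists_equivariant_monoidalTransform` (`B = S[J/t]`, `a₀ ↦ t`):

* `stalkClosedPointTo_surjective_of_localizedChart` — `stalkClosedPointTo φ : 𝒪_{X',x'} → R` is SURJECTIVE for the
  chart `φ : Spec R → X'` over `Spec R → X` (`I_x 𝒪_{X',x'}` is principal, generated — by locality — by the image
  of `a₀`; hence every `m/a₀`, `m ∈ I_x`, is hit, so `B` is, and the unit denominators lift);
* ★ `nonempty_stalk_ringEquiv_of_localizedChart` — with ✓`stalkClosedPointTo_injective_of_isBlowup`: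
  **`𝒪_{X',x'} ≃+* R`**; `isRegularLocalRing_stalk_of_localizedChart` — so `x'` is a REGULAR point when `R` is
  regular (the Kollár–Szabó fixed point on the blow-up along a regular stable centre, ✓`KSCentreFixedPoint`, once its
  chart is exported with the localisation data).

[OURS · crux stmt-ResolutionOfSingularities-15640 · helper toward `stub_phaseZeroHighDim` ((K2-centres-stalk); NOT a
proof of the stub); folklore (Stacks 0804), counted 0; AI-level work, weaker than expert review.]
[cite: StacksProject, Tag 0804]
-/

-- single-problem summit: the doubled namespace component `ResolutionOfSingularities` is forced
set_option linter.dupNamespace false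

noncomputable section

open CategoryTheory CategoryTheory.Limits AlgebraicGeometry TopologicalSpace IsLocalRing
open Literature.AlgebraicGeometry.Ramification Literature.AlgebraicGeometry.Resolution
open Scheme.IdealSheafData
open Summit.ResolutionOfSingularities.ResolutionOfSingularities.Theorems.WildQuotientResolution
open Summit.ResolutionOfSingularities.ResolutionOfSingularities.Theorems.WildQuotientResolution.KSGoingDown

namespace Summit.ResolutionOfSingularities.ResolutionOfSingularities.Theorems.WildQuotientResolution.CentreChart

universe u

variable {X' X : Scheme.{u}} {π : X' ⟶ X} {x : X} [IsIntegral X]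

set_option maxHeartbeats 800000 in
-- the stalk maps of the blowing up and the `Subring K` coercions elaborate large terms (as in hand 8-g2's
-- `KSBlowupFixedPointCentre.lean`, from which this proof is adapted)
/-- **`stalkClosedPointTo φ : 𝒪_{X',x'} → R` is surjective for a localised chart of the blow-up along any centre.**
Let `π : X' → X` be a blowing up along `I`, `R ⊆ K = Frac 𝒪_{X,x}` a local subring with a LOCAL structure map
`ι : 𝒪_{X,x} → R` (the inclusion), `a₀ ∈ I_x`, `a₀ ≠ 0`, with `I_x R = (ι a₀)`, and `B ⊆ K` a subring contained in
`S[I_x/a₀]` (`S = im 𝒪_{X,x}`) of which `R` is a localisation: every `r ∈ R` is `a/b` with `a, b ∈ B`, `b⁻¹ ∈ R`.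
Then for the chart `φ : Spec R → X'` over `Spec R → X` the map `𝒪_{X',x'} → R` at `x' = φ(closed point)` is onto.
(Hand 8-g2's quadratic-transform case: `I_x = 𝔪_x`, `B = S[𝔪/x₀]`.) [cite: StacksProject, Tag 0804] -/
theorem stalkClosedPointTo_surjective_of_localizedChart [IsIntegral X']
    {I : X.IdealSheafData} (hπ : IsBlowup π I)
    (R : Subring (FractionRing (X.presheaf.stalk x))) [IsLocalRing R]
    (ι : X.presheaf.stalk x →+* R) [IsLocalHom ι]
    (hι : ∀ a, ((ι a : R) : FractionRing (X.presheaf.stalk x)) =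
      algebraMap (X.presheaf.stalk x) (FractionRing (X.presheaf.stalk x)) a)
    {a₀ : X.presheaf.stalk x} (ha₀ : a₀ ∈ stalkIdeal I x) (ha₀0 : a₀ ≠ 0)
    (hmap : (stalkIdeal I x).map ι = Ideal.span {ι a₀})
    (B : Subring (FractionRing (X.presheaf.stalk x)))
    (hBle : B ≤ Subring.closure
      (((algebraMap (X.presheaf.stalk x) (FractionRing (X.presheaf.stalk x))).range : Set _) ∪
        {z | ∃ m ∈ stalkIdeal I x, z = algebraMap _ (FractionRing (X.presheaf.stalk x)) m /
          algebraMap _ (FractionRing (X.presheaf.stalk x)) a₀}))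
    (hfrac : ∀ r : R, ∃ a ∈ B, ∃ b ∈ B, b⁻¹ ∈ R ∧ (r : FractionRing (X.presheaf.stalk x)) = a / b)
    (φ : Spec (.of R) ⟶ X') (hφ : φ ≫ π = Spec.map (CommRingCat.ofHom ι) ≫ X.fromSpecStalk x) :
    Function.Surjective (Scheme.stalkClosedPointTo φ).hom := by
  -- adapted from hand 8-g2's `KSGoingDown.stalkClosedPointTo_surjective_of_isQuadraticTransform_of_stalkIdeal`
  classical
  set K := FractionRing (X.presheaf.stalk x) with hK
  set y := φ (closedPoint R) with hy
  set ψ := (Scheme.stalkClosedPointTo φ).hom with hψ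
  set T := (π.stalkMap y).hom with hT
  have hyx : π y = x := π_apply_closedPoint_eq ι φ hφ
  -- the specialization isomorphisms `σ₀ : 𝒪_{X,π y} → 𝒪_{X,x}`, `σ₁` its inverse
  set σ₀ := (X.presheaf.stalkSpecializes (specializes_of_eq hyx.symm)).hom with hσ₀
  set σ₁ := (X.presheaf.stalkSpecializes (specializes_of_eq hyx)).hom with hσ₁
  have hσ₁₀ : ∀ a, σ₁ (σ₀ a) = a := fun a => by
    rw [hσ₀, hσ₁, ← CommRingCat.comp_apply, TopCat.Presheaf.stalkSpecializes_comp]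
    simp
  have hσ₀₁ : ∀ a, σ₀ (σ₁ a) = a := fun a => by
    rw [hσ₀, hσ₁, ← CommRingCat.comp_apply, TopCat.Presheaf.stalkSpecializes_comp]
    simp
  have hcomp : ∀ a, ψ (T a) = ι (σ₀ a) := fun a => stalkClosedPointTo_stalkMap_apply ι φ hφ a
  have hcomp' : ∀ a, ψ (T (σ₁ a)) = ι a := fun a => by rw [hcomp, hσ₀₁]
  -- the stalks of `I` at `π y` and at `x` correspond under `σ₁`
  have hIσ₁ : ∀ m ∈ stalkIdeal I x, σ₁ m ∈ stalkIdeal I (π y) := by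
    intro m hm
    rw [← stalkIdeal_map_stalkSpecializes I (specializes_of_eq hyx)]
    exact Ideal.mem_map_of_mem _ hm
  have ha₀0K : algebraMap _ K a₀ ≠ 0 := fun h =>
    ha₀0 ((IsFractionRing.to_map_eq_zero_iff (K := K)).mp h)
  -- `tR = ι a₀`
  set tR : R := ι a₀ with htR
  have htRK : (tR : K) = algebraMap _ K a₀ := hι a₀
  have htR0 : tR ≠ 0 := fun h => ha₀0K (by rw [← htRK, h]; rfl)
  -- `I 𝒪_{X',y}` is principal: `= (g)`
  obtain ⟨g, hg0, hg⟩ := hπ.isEffectiveCartier.exists_stalkIdeal_eq_span y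
  rw [stalkIdeal_comap_eq_map] at hg
  -- images under `ψ`: `ψ (I_{π y} 𝒪_{X',y}) = (tR)`
  have hψmap : ((stalkIdeal I (π y)).map T).map ψ = Ideal.span {tR} := by
    rw [← hmap]
    apply le_antisymm
    · refine (Ideal.map_le_iff_le_comap).mpr ((Ideal.map_le_iff_le_comap).mpr fun m hm => ?_)
      rw [Ideal.mem_comap, Ideal.mem_comap, hcomp]
      refine Ideal.mem_map_of_mem ι ?_
      rw [← stalkIdeal_map_stalkSpecializes I (specializes_of_eq hyx.symm)]
      exact Ideal.mem_map_of_mem _ hm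
    · refine (Ideal.map_le_iff_le_comap).mpr fun m hm => ?_
      rw [Ideal.mem_comap, ← hcomp' m]
      exact Ideal.mem_map_of_mem ψ (Ideal.mem_map_of_mem T (hIσ₁ m hm))
  rw [hg, Ideal.map_span, Set.image_singleton] at hψmap
  -- `T (σ₁ a₀) = g * w` with `ψ w` a unit, hence `w` a unit
  have ha₀T : T (σ₁ a₀) ∈ Ideal.span {g} := by
    rw [← hg]
    exact Ideal.mem_map_of_mem _ (hIσ₁ a₀ ha₀)
  obtain ⟨w, hw⟩ := Ideal.mem_span_singleton'.mp ha₀T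
  have hψg : ψ g ∈ Ideal.span {tR} := hψmap ▸ Ideal.subset_span rfl
  obtain ⟨v, hv⟩ := Ideal.mem_span_singleton'.mp hψg
  have hwu : IsUnit w := by
    have h1 : tR = v * ψ w * tR := by
      have := congrArg ψ hw
      rw [map_mul, hcomp', ← hv] at this
      linear_combination (-1 : R) * this
    have h2 : v * ψ w = 1 := by
      have h3 : (v * ψ w - 1) * tR = 0 := by linear_combination (-1 : R) * h1
      rcases mul_eq_zero.mp h3 with h | h
      · exact (sub_eq_zero.mp h)
      · exact absurd h htR0
    have hψw : IsUnit (ψ w) := IsUnit.of_mul_eq_one_right v h2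
    exact (isUnit_map_iff ψ w).mp hψw
  -- every `m ∈ I_x` has `T(σ₁ m) = T(σ₁ a₀) · M'`
  have hdiv : ∀ m ∈ stalkIdeal I x, ∃ M', T (σ₁ m) = T (σ₁ a₀) * M' := by
    intro m hm
    have h1 : T (σ₁ m) ∈ Ideal.span {g} := by
      rw [← hg]
      exact Ideal.mem_map_of_mem _ (hIσ₁ m hm)
    obtain ⟨c, hc⟩ := Ideal.mem_span_singleton'.mp h1
    refine ⟨c * ↑(hwu.unit⁻¹), ?_⟩
    rw [← hw, ← hc]
    have : w * ↑(hwu.unit⁻¹) = 1 := hwu.mul_val_inv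
    linear_combination (-(c * g)) * this
  -- the image of `ψ` read in `K` contains `B`
  let Q : Subring K := (ψ.range).map R.subtype
  have hQ : ∀ z : K, z ∈ Q ↔ ∃ Z, ((ψ Z : R) : K) = z := by
    intro z
    simp only [Q, Subring.mem_map, RingHom.mem_range, Subring.coe_subtype]
    constructor
    · rintro ⟨r, ⟨Z, rfl⟩, rfl⟩; exact ⟨Z, rfl⟩
    · rintro ⟨Z, hZ⟩; exact ⟨ψ Z, ⟨Z, rfl⟩, hZ⟩
  have hBQ : B ≤ Q := by
    refine hBle.trans (Subring.closure_le.mpr ?_)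
    rintro z (⟨a, rfl⟩ | ⟨m, hm, rfl⟩)
    · exact (hQ _).mpr ⟨T (σ₁ a), by rw [hcomp', hι]⟩
    · obtain ⟨M', hM'⟩ := hdiv m hm
      refine (hQ _).mpr ⟨M', ?_⟩
      have h1 : ψ (T (σ₁ m)) = tR * ψ M' := by rw [hM', map_mul, hcomp' a₀]
      rw [hcomp'] at h1
      have h2 : ((ι m : R) : K) = (tR : K) * ((ψ M' : R) : K) := by
        rw [h1]; rfl
      rw [hι, htRK] at h2
      change ((ψ M' : R) : K) = algebraMap _ K m / algebraMap _ K a₀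
      rw [eq_div_iff ha₀0K, mul_comm, ← h2]
  -- conclusion
  intro r
  obtain ⟨a, haB, b, hbB, hbinv, hrab⟩ := hfrac r
  obtain ⟨A, hA⟩ := (hQ a).mp (hBQ haB)
  obtain ⟨Bz, hB⟩ := (hQ b).mp (hBQ hbB)
  by_cases hb0 : b = 0
  · refine ⟨0, Subtype.ext ?_⟩
    rw [map_zero, hrab, hb0, div_zero]
    rfl
  · have hbu : IsUnit (ψ Bz) := (isUnit_subring_iff_inv_mem _).mpr ⟨by rw [hB]; exact hb0, by
      rw [hB]; exact hbinv⟩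
    have hBu : IsUnit Bz := (isUnit_map_iff ψ Bz).mp hbu
    refine ⟨A * ↑(hBu.unit⁻¹), Subtype.ext ?_⟩
    have hinv : ψ ↑(hBu.unit⁻¹) * ψ Bz = 1 := by
      rw [← map_mul, IsUnit.val_inv_mul, map_one]
    have hinvK : ((ψ ↑(hBu.unit⁻¹) : R) : K) = b⁻¹ := by
      have := congrArg (fun r : R => (r : K)) hinv
      simp only [Subring.coe_mul, Subring.coe_one, hB] at this
      exact eq_inv_of_mul_eq_one_left this
    rw [map_mul, Subring.coe_mul, hA, hinvK, hrab, div_eq_mul_inv]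

/-- **`𝒪_{X',x'} ≃+* R`** for a localised chart of the blow-up along any centre (surjectivity above + hand 8-g2's
✓`stalkClosedPointTo_injective_of_isBlowup`). [cite: StacksProject, Tag 0804] -/
theorem nonempty_stalk_ringEquiv_of_localizedChart [IsLocallyNoetherian X] [IsIntegral X']
    {I : X.IdealSheafData} (hπ : IsBlowup π I)
    (R : Subring (FractionRing (X.presheaf.stalk x))) [IsLocalRing R]
    (ι : X.presheaf.stalk x →+* R) [IsLocalHom ι]
    (hι : ∀ a, ((ι a : R) : FractionRing (X.presheaf.stalk x)) =
      algebraMap (X.presheaf.stalk x) (FractionRing (X.presheaf.stalk x)) a)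
    {a₀ : X.presheaf.stalk x} (ha₀ : a₀ ∈ stalkIdeal I x) (ha₀0 : a₀ ≠ 0)
    (hmap : (stalkIdeal I x).map ι = Ideal.span {ι a₀})
    (B : Subring (FractionRing (X.presheaf.stalk x)))
    (hBle : B ≤ Subring.closure
      (((algebraMap (X.presheaf.stalk x) (FractionRing (X.presheaf.stalk x))).range : Set _) ∪
        {z | ∃ m ∈ stalkIdeal I x, z = algebraMap _ (FractionRing (X.presheaf.stalk x)) m /
          algebraMap _ (FractionRing (X.presheaf.stalk x)) a₀}))
    (hfrac : ∀ r : R, ∃ a ∈ B, ∃ b ∈ B, b⁻¹ ∈ R ∧ (r : FractionRing (X.presheaf.stalk x)) = a / b)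
    (φ : Spec (.of R) ⟶ X') (hφ : φ ≫ π = Spec.map (CommRingCat.ofHom ι) ≫ X.fromSpecStalk x)
    {x' : X'} (hx' : φ (closedPoint R) = x') :
    Nonempty (X'.presheaf.stalk x' ≃+* R) := by
  subst hx'
  have hιinj : Function.Injective ι := fun a b h => by
    apply IsFractionRing.injective (X.presheaf.stalk x) (FractionRing (X.presheaf.stalk x))
    rw [← hι, ← hι, h]
  exact ⟨RingEquiv.ofBijective (Scheme.stalkClosedPointTo φ).hom
    ⟨stalkClosedPointTo_injective_of_isBlowup hπ ι hιinj φ hφ,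
      stalkClosedPointTo_surjective_of_localizedChart hπ R ι hι ha₀ ha₀0 hmap B hBle hfrac φ hφ⟩⟩

/-- **The point of a REGULAR localised chart is a regular point**: `𝒪_{X',x'}` is a regular local ring when `R` is
(transport along `𝒪_{X',x'} ≃+* R`). For the Kollár–Szabó fixed point on the blow-up along a regular stable
centre (✓`CentreChart.exists_fixedPoint_liftAction_of_regularCentre`, whose chart `R = S[J/t]_𝔫` is regular).
[cite: StacksProject, Tag 0804] [cite: Liu2002, Thm. 8.1.19 (a)] -/
theorem isRegularLocalRing_stalk_of_localizedChart [IsLocallyNoetherian X] [IsIntegral X']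
    {I : X.IdealSheafData} (hπ : IsBlowup π I)
    (R : Subring (FractionRing (X.presheaf.stalk x))) [IsRegularLocalRing R]
    (ι : X.presheaf.stalk x →+* R) [IsLocalHom ι]
    (hι : ∀ a, ((ι a : R) : FractionRing (X.presheaf.stalk x)) =
      algebraMap (X.presheaf.stalk x) (FractionRing (X.presheaf.stalk x)) a)
    {a₀ : X.presheaf.stalk x} (ha₀ : a₀ ∈ stalkIdeal I x) (ha₀0 : a₀ ≠ 0)
    (hmap : (stalkIdeal I x).map ι = Ideal.span {ι a₀})
    (B : Subring (FractionRing (X.presheaf.stalk x)))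
    (hBle : B ≤ Subring.closure
      (((algebraMap (X.presheaf.stalk x) (FractionRing (X.presheaf.stalk x))).range : Set _) ∪
        {z | ∃ m ∈ stalkIdeal I x, z = algebraMap _ (FractionRing (X.presheaf.stalk x)) m /
          algebraMap _ (FractionRing (X.presheaf.stalk x)) a₀}))
    (hfrac : ∀ r : R, ∃ a ∈ B, ∃ b ∈ B, b⁻¹ ∈ R ∧ (r : FractionRing (X.presheaf.stalk x)) = a / b)
    (φ : Spec (.of R) ⟶ X') (hφ : φ ≫ π = Spec.map (CommRingCat.ofHom ι) ≫ X.fromSpecStalk x)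
    {x' : X'} (hx' : φ (closedPoint R) = x') :
    IsRegularLocalRing (X'.presheaf.stalk x') := by
  obtain ⟨e⟩ := nonempty_stalk_ringEquiv_of_localizedChart hπ R ι hι ha₀ ha₀0 hmap B hBle hfrac φ hφ hx'
  exact IsRegularLocalRing.of_ringEquiv e.symm

end Summit.ResolutionOfSingularities.ResolutionOfSingularities.Theorems.WildQuotientResolution.CentreChart

end
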